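import Summits.BirchSwinnertonDyer.Rank1Residual.GaloisImage.KolyvaginSystemOfEulerSystem
import Summits.BirchSwinnertonDyer.Rank1Residual.GaloisImage.KolyvaginTransverseRat
import HarnessLib

/-!
# THEOREM D of row T-DER with the transverse clause DISCHARGED (T-DER-TR, n1011-p15): the
# derivative family of an Euler system of `T_p E / ℚ` is a Kolyvagin system for
# `(E[m], 𝓕, 𝒫)` with the CYCLOTOMIC transverse conditions — only the `S`-places displayed
# (cell `b2b-bsdres`, n1011 p11 GEN 10; row T-DER, THEOREM D file D3b)

HONEST FRAMING (cell `b2b-bsdres`, run/shared/lean/b2b/bsd-rank1-residual/, verbatim in every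
file): the goal of the cell is to DELETE the COMBINATION-SHAPED residual classes of the
Birch–Swinnerton-Dyer formula for ALL analytic-rank `≤ 1` elliptic curves over `ℚ` — "full BSD
formula for every rank `≤ 1` curve in class `C`" assembled STRICTLY from published theorems — so
that the rank-`≤ 1` remainder becomes exactly the CONSTRUCTION-SHAPED classes, which are TYPED
(missing-input `Prop`s), NOT attempted. This is not "finishing BSD". Team n1011: research route on
the CONSTRUCTION-SHAPED class X4 / §I N11 (route-1 PORT, (P-DER), clause C1/C0); TOOL theorem: NO
Euler system is asserted to exist (it is the hypothesis `hc`), no definition, no named fact, no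
`sorry`.

## What

D3 `Derivative.Rat.isKolyvaginSystem_derivativeFamily` displays the transverse clause
`htr : loc_q (κ d) ∈ D.transverse (inr q)` (`q ∈ d`).  When the datum's transverse conditions are
the cyclotomic ones (`hT : D.transverse = cyclotomicTransverse _`, as in every datum of the cell:
`KolyvaginDatum.IsCanonicalTauDatumThreeAt`, `FSComp.exists_kolyvaginDatum_hasCanonicalComparison_frobeniusClassPrimes`),
the clause is n1011-p15's THEOREM D-tr (`Derivative.Transverse.Rat.localization_map_deriv_mem_cyclotomicTransverse`,
[MR04] Thm. A.4 / [Rubin2011] Thm. 4.3.12: the derivative class is transverse at the primes of its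
level) applied along the GZ-1 glue `Φ₀ : H¹(ℚ, T′) ≃ H¹(ℚ, E[m])` to the pulled-back class
`Φ₀⁻¹ (κ d)` (C5b-β′ `CoeffTransport.resSubgroup_symm_eq_noncommProd_deriv`).  Result:
**`isKolyvaginSystem_derivativeFamily_of_transverse_eq`** — `D.IsKolyvaginSystem 𝓕 κ` with only the
finitely many `S`-places (and `p`) displayed (`hSloc`).
0 defs, 0 facts.  References: B. Mazur, K. Rubin, Mem. AMS 799 (2004), Thm. 3.2.4, App. A;
K. Rubin, PCMI 18 (2011), Thm. 4.3.10 and Thm. 4.3.12; R. Sakamoto, JTNB 36 (2024), Def. 4.1.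
-/

noncomputable section

open CategoryTheory Function Finset Polynomial Field IsDedekindDomain
open scoped NumberField
open Literature.NumberTheory.GaloisRepresentations Literature.NumberTheory.EllipticCurves
open Literature.NumberTheory.GaloisRepresentations.DiscreteGaloisModule
open Literature.NumberTheory.GaloisCohomology
open Summit.BirchSwinnertonDyer.Rank1Residual.GaloisImage.CoeffTransport
open Summit.BirchSwinnertonDyer.Rank1Residual.GaloisImage.CyclotomicLevel
open Rat.HeightOneSpectrum

universe u

namespace Summit.BirchSwinnertonDyer.Rank1Residual.GaloisImage.Derivative.Rat

variable (W : WeierstrassCurve ℚ) [W.IsElliptic] [W.IsGloballyMinimal] (p : ℕ) [Fact p.Prime]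
variable [Module.Free ℤ_[p] (W.tateModule p)] [Module.Finite ℤ_[p] (W.tateModule p)]
  [ContinuousSMul ℤ_[p] (W.tateModule p)]

/-- Local notation: `T∞ = T_p E` as a continuous `G_ℚ`-representation. -/
local notation3 "T∞" => WeierstrassCurve.tateGaloisRep W p (W.continuous_galoisRepTate_holds p)

/-- Local notation: `𝐫⟦f, T′, U⟧ = f_* : H¹(U, T_pE) → H¹(U, T′)`. -/
local notation3 (prettyPrint := false) "𝐫⟦" f ", " Tg ", " U "⟧" =>
  ContinuousCohomology.map (ContinuousMonoidHom.id _)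
    (X := subgroupRep (ContinuousRep.toTopRep T∞) U)
    (Y := subgroupRep (ContinuousRep.toTopRep Tg) U)
    ((TopRep.resFunctor (Subgroup.subtype U)).map f) 1

variable (S : Set (HeightOneSpectrum (𝓞 ℚ)))

/-- Local notation: `𝓛` = the cyclotomic Euler-system levels `ℚ(μ_{p^{n+1}}, μ_r)`, `r ∩ S = ∅`. -/
local notation3 "𝓛" => cyclotomicLevelsRat p S

/-- Local notation: `𝐃⟦A, X, U, τ⟧ ℓ = ∑_{j < ℓ−1} j·(τ_ℓ)_*^j`, Kolyvagin's derivative operator of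
the place `ℓ` on `H¹(U, X)` (`A`-linear) for the generator `τ_ℓ`. -/
local notation3 (prettyPrint := false) "𝐃⟦" A ", " X ", " U ", " τ "⟧" =>
  fun ℓ : HeightOneSpectrum (𝓞 ℚ) =>
  ∑ j ∈ Finset.range (((primesEquiv ℓ : Nat.Primes) : ℕ) - 1),
    (j : Module.End A (continuousCohomology 1 (subgroupRep X U))) *
      (conjMap X U ((τ : HeightOneSpectrum (𝓞 ℚ) → absoluteGaloisGroup ℚ) ℓ) 1).hom.toLinearMap ^ j

/-- **THEOREM D with the cyclotomic transverse conditions: the derivative family of an Euler system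
of `T_pE` is a Kolyvagin system for `(E[m], 𝓕, 𝒫)`, only the `S`-places displayed.**  As D3
`isKolyvaginSystem_derivativeFamily` (see that docstring for every binder) with
`hT : D.transverse = cyclotomicTransverse _` in place of the transverse clause `htr`, which is
DISCHARGED by n1011-p15's `Transverse.Rat.localization_map_deriv_mem_cyclotomicTransverse`.
[cite: MazurRubin2004, Thm. 3.2.4 and App. A (Prop. A.2, Thm. A.4)]
[cite: Rubin2011, Thm. 4.3.10 and Thm. 4.3.12] [cite: Sakamoto2024, Def. 4.1 (p. 926)] -/
theorem isKolyvaginSystem_derivativeFamily_of_transverse_eq (hp2 : p ≠ 2)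
    {c : ∀ (i : ℕ) (r : (𝓛).Ideals), H1 T∞ ((𝓛).level i r.1)}
    (hc : IsEulerSystem 𝓛 T∞ p c)
    {M' : Type} [AddCommGroup M'] [Module ℤ_[p] M'] [TopologicalSpace M'] [DiscreteTopology M']
    [IsTopologicalAddGroup M'] [ContinuousSMul ℤ_[p] M'] {T' : GaloisRep ℚ ℤ_[p] M'}
    (red : T∞.toTopRep ⟶ T'.toTopRep) (hred : Function.Surjective red.hom)
    {n : ℕ} (hn : 0 < n) (hM : ∀ m : M', ((p : ℤ_[p]) ^ n) • m = 0)
    {m : ℤ} (hm : m = ((p ^ n : ℕ) : ℤ))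
    [Module (ZMod (p ^ n)) (WeierstrassCurve.geomTorsion W m)]
    [Module.Free (ZMod (p ^ n)) (WeierstrassCurve.geomTorsion W m)]
    [Module.Finite (ZMod (p ^ n)) (WeierstrassCurve.geomTorsion W m)]
    (e : M' →+ WeierstrassCurve.geomTorsion W m) (hec : Continuous e)
    (he : ∀ (g : absoluteGaloisGroup ℚ) (x : M'),
      e (T'.toTopRep.ρ g x) = (W.torsionGaloisModule m).toTopRep.ρ g (e x))
    (einv : WeierstrassCurve.geomTorsion W m →+ M') (hic : Continuous einv)
    (h₁ : ∀ x, einv (e x) = x) (h₂ : ∀ y, e (einv y) = y)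
    (D : KolyvaginDatum (W.torsionGaloisModule m))
    (hT : D.transverse = cyclotomicTransverse (W.torsionGaloisModule m))
    {η : (ℓ : HeightOneSpectrum (𝓞 ℚ)) → (ZMod (Ideal.absNorm ℓ.asIdeal))ˣ}
    (hD : D.HasCanonicalComparison (p ^ n) η)
    (hPr : D.primes ⊆ (𝓛).primes)
    (hKol : ∀ ℓ ∈ D.primes, Kato.IsKolyvaginPrime W p n ((primesEquiv ℓ : Nat.Primes) : ℕ))
    (σ : HeightOneSpectrum (𝓞 ℚ) → absoluteGaloisGroup ℚ)
    (hσI : ∀ ℓ ∈ D.primes, σ ℓ ∈ (adicCompletionPrime ℚ ℓ).inertia (absoluteGaloisGroup ℚ))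
    (hσχ : ∀ ℓ ∈ D.primes, modNCyclotomicCharacter ℚ (Ideal.absNorm ℓ.asIdeal) (σ ℓ) = η ℓ)
    (hσ : ∀ r : Finset (HeightOneSpectrum (𝓞 ℚ)), (↑r : Set _) ⊆ D.primes →
      (∀ ℓ ∈ r, ∀ ℓ₂ ∈ r, ℓ₂ ≠ ℓ → σ ℓ ∈ (𝓛).tameLevel ℓ₂) ∧
      (∀ ℓ ∈ r, ∀ g : absoluteGaloisGroup ℚ,
        ∃ j < ((primesEquiv ℓ : Nat.Primes) : ℕ) - 1, (σ ℓ ^ j)⁻¹ * g ∈ (𝓛).tameLevel ℓ) ∧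
      (∀ ℓ ∈ r, ∀ j₁ < ((primesEquiv ℓ : Nat.Primes) : ℕ) - 1,
        ∀ j₂ < ((primesEquiv ℓ : Nat.Primes) : ℕ) - 1,
          (σ ℓ ^ j₁)⁻¹ * σ ℓ ^ j₂ ∈ (𝓛).tameLevel ℓ → j₁ = j₂))
    (h0 : ∀ r : Finset (HeightOneSpectrum (𝓞 ℚ)), (↑r : Set _) ⊆ D.primes →
      ∀ P : WeierstrassCurve.geomTorsion W m,
        (∀ u : (𝓛).level ⊥ r, (u : absoluteGaloisGroup ℚ) • P = P) → P = 0)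
    (Φ : ∀ r : Finset (HeightOneSpectrum (𝓞 ℚ)),
        continuousCohomology 1 (subgroupRep T'.toTopRep ((𝓛).level ⊥ r)) →+
          continuousCohomology 1 (subgroupRep (W.torsionGaloisModule m).toTopRep ((𝓛).level ⊥ r)))
    (hΦ : ∀ r, ∀ (φ : contOneCocycles (subgroupRep T'.toTopRep ((𝓛).level ⊥ r)))
      (ψ : contOneCocycles (subgroupRep (W.torsionGaloisModule m).toTopRep ((𝓛).level ⊥ r))),
      (∀ g, ψ.1 g = e (φ.1 g)) → Φ r (oneCocycleClass _ φ) = oneCocycleClass _ ψ)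
    (comm : ∀ r : Finset (HeightOneSpectrum (𝓞 ℚ)),
        ((r : Finset _) : Set (HeightOneSpectrum (𝓞 ℚ))).Pairwise fun a b =>
          Commute (𝐃⟦ℤ, (W.torsionGaloisModule m).toTopRep, ((𝓛).level ⊥ r), σ⟧ a)
            (𝐃⟦ℤ, (W.torsionGaloisModule m).toTopRep, ((𝓛).level ⊥ r), σ⟧ b))
    (κ : Finset (HeightOneSpectrum (𝓞 ℚ)) → galoisCohomology (W.torsionGaloisModule m) 1)
    (hκ0 : ∀ r : Finset (HeightOneSpectrum (𝓞 ℚ)), ¬ (↑r : Set _) ⊆ D.primes → κ r = 0)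
    (hκ : ∀ (r : Finset (HeightOneSpectrum (𝓞 ℚ))) (hr : (↑r : Set _) ⊆ D.primes),
      resSubgroup (W.torsionGaloisModule m).toTopRep ((𝓛).level ⊥ r) 1 (κ r) =
        (r.noncommProd 𝐃⟦ℤ, (W.torsionGaloisModule m).toTopRep, ((𝓛).level ⊥ r), σ⟧ (comm r))
          (Φ r (𝐫⟦red, T', ((𝓛).level ⊥ r)⟧
            (c ⊥ ⟨r, fun _ hq => hPr (hr (Finset.mem_coe.2 hq))⟩))))
    (𝓕 : SelmerStructure (W.torsionGaloisModule m))
    (hunr : ∀ w : HeightOneSpectrum (𝓞 ℚ), W.HasGoodReductionAt w →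
      ((primesEquiv w : Nat.Primes) : ℕ) ≠ p →
        unramifiedSubgroup (GaloisRep.toLocal w (W.torsionGaloisModule m)) 1 ≤ 𝓕 (Sum.inr w))
    (hSloc : ∀ (r : Finset (HeightOneSpectrum (𝓞 ℚ))), (↑r : Set _) ⊆ D.primes →
      ∀ w : HeightOneSpectrum (𝓞 ℚ), w ∉ r →
        ¬ (W.HasGoodReductionAt w ∧ ((primesEquiv w : Nat.Primes) : ℕ) ≠ p) →
          galoisCohomology.localization (W.torsionGaloisModule m) (Sum.inr w) 1 (κ r) ∈ 𝓕 (Sum.inr w)) :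
    D.IsKolyvaginSystem 𝓕 κ := by
  classical
  -- the global transport (GZ-1)
  obtain ⟨Φ₀, hΦ₀⟩ := exists_addEquiv_oneCocycleClass T'.toTopRep (W.torsionGaloisModule m).toTopRep
    e hec he einv hic h₁ h₂
  refine isKolyvaginSystem_derivativeFamily W p S hp2 hc red hred hn hM hm e hec he einv hic h₁ h₂ D hD
    hPr hKol σ hσI hσχ hσ h0 Φ hΦ comm κ hκ0 hκ 𝓕 hunr hSloc fun d hd q hqd => ?_
  rw [hT]
  -- `T′` is unramified at `q` (good, `q ∤ p`), through `e`
  have hqD : q ∈ D.primes := hd (Finset.mem_coe.2 hqd)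
  have hqgood : W.HasGoodReductionAt q :=
    CyclotomicLevel.Rat.hasGoodReductionAt_of_isKolyvaginPrime W (hKol q hqD)
  have hne : ((primesEquiv q : Nat.Primes) : ℕ) ≠ p := (hKol q hqD).ne
  have hpq : ((p : ℕ) : 𝓞 ℚ) ∉ q.asIdeal :=
    WeierstrassCurve.natCast_not_mem_asIdeal_of_primesEquiv_ne Fact.out hne
  have hmq : ((m : ℤ) : 𝓞 ℚ) ∉ q.asIdeal := by
    rw [hm, Int.cast_natCast, Nat.cast_pow]
    exact fun h => hpq (q.isPrime.mem_of_pow_mem n h)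
  have hT' : T'.IsUnramifiedAt q := by
    intro 𝔓 h𝔓 u hu
    ext x
    have h := he u x
    rw [show (W.torsionGaloisModule m).toTopRep.ρ u (e x) = e x from by
      change W.torsionGaloisModule m u (e x) = e x
      rw [WeierstrassCurve.torsionGaloisModule_apply_apply]
      exact W.smul_geomTorsion_eq_of_mem_inertia hqgood hmq h𝔓 hu (e x)] at h
    have h' := congrArg einv h
    rw [h₁, h₁] at h'
    exact h'
  -- `h0` in `T′`-currency
  have h0' : ∀ v : T'.toTopRep, (∀ u : (𝓛).level ⊥ d,
      T'.toTopRep.ρ (u : absoluteGaloisGroup ℚ) v = v) → v = 0 := by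
    intro v hv
    have h := h0 d hd (e v) fun u => by
      have := congrArg e (hv u)
      rw [he] at this
      exact this
    have := congrArg einv h
    rwa [h₁, map_zero] at this
  -- the pulled-back class and THEOREM D-tr (n1011-p15)
  have hκX := resSubgroup_symm_eq_noncommProd_deriv T'.toTopRep (W.torsionGaloisModule m).toTopRep e
    hec he einv h₁ h₂ ((𝓛).level ⊥ d) Φ₀ hΦ₀ (Φ d) (hΦ d) σ _ d
    (pairwise_commute_deriv (L := 𝓛) (T' := T') ⊥ d σ
      (fun ℓ => ((primesEquiv ℓ : Nat.Primes) : ℕ) - 1)) (comm d) _ (κ d) (hκ d hd)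
  rw [← Φ₀.apply_symm_apply (κ d)]
  exact Transverse.Rat.localization_map_deriv_mem_cyclotomicTransverse W S hp2 hc red hn hM
    ⟨d, fun _ hq => hPr (hd (Finset.mem_coe.2 hq))⟩ hqd
    (fun ℓ hℓ => hKol ℓ (hd (Finset.mem_coe.2 hℓ))) σ (hσ d hd).1 (hσ d hd).2.1 (hσ d hd).2.2
    h0' hT' _ (Φ₀.symm (κ d)) hκX (W.torsionGaloisModule m) e hec (fun g x => he g x)
    Φ₀.toAddMonoidHom (fun φ ψ h => hΦ₀ φ ψ h)

end Summit.BirchSwinnertonDyer.Rank1Residual.GaloisImage.Derivative.Rat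

end
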